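import Mathlib
import HarnessLib
import HarnessLib.Audit
import Summits.FinalStateConjecture.Statement
import Literature.Geometry.Lorentzian.TameBreathingCurve
import Literature.Geometry.Lorentzian.TameGenericityDiagonal

/-!
Route: RobustClausewiseGenericity

DORMANT since 2026-09-04T19:05:16Z (reconciler: no traction for 5 d (last activity statement-checked at 2026-08-30T17:45:39Z); parked, not closed — `ledger route dormant route-FinalStateConjecture-RobustClausewiseGenericity --off` to re) — unstaffed, not closed; items shared with open routes are served there. `ledger route dormant <id> --off` reactivates.

# Route RobustClausewiseGenericity — clause-wise genericity that survives enrichment of the probe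
assembles — robust escape of the censorship, settling and third-law strata plus an elementary
conjunction lemma

It suffices to show X = X_B ∧ X_C ∧ X_S ∧ M (route for card genericity-is-not-closed-under-and, its
positive half K1/P2 made clause-wise; re-typed for statement revision T2, p126844, 2026-08-16;
crux-only deciding theorem since route-repair 2026-08-17):
X_C = SettlingRobust, X_B = CensorshipRobust, X_S = ThirdLawRobust say that each of the three
syntactic clauses of the summit property —
(C) every MGHD admits an exhaustive charted Kerr decomposition (|aᵢ| ≤ Mᵢ, as the structure
FinalStateDecomposition allows) whose settled region O = exteriorOf is ray-closed
(RaysStayInClosure), with honest near-zone radii (HasExhaustiveCharts, 3-tuple form) and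
future-oriented chart time (IsFutureOriented) — the re-typed summit settling clause minus
sub-extremality,
(B) every MGHD has complete 𝓘⁺, (S) no exhaustive decomposition of an MGHD has a non-sub-extremal
hole — is ROBUSTLY ESCAPABLE at
every admissible datum: escapable along an open dense set of radial directions of a compactly
supported finite-dimensional admissible
probe, STABLY UNDER ENRICHING THE PROBE. M = MGHDExists (Choquet-Bruhat–Geroch; the Statement's own
anti-vacuity conjunct, a paper theorem unproved in tree, XL) is the fourth, last-ranked CRUX
(re-badged support→crux 2026-08-17: a load-bearing hypothesis of the deciding theorem that cannot be
a proved glue lemma; shared item of the summit's routes). TAME Christodoulou-genericity of the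
conjunction (`InitialDataSet.IsTameChristodoulouGeneric 𝓓 P 1` = `FinalStateConjecture` since
p126844) then follows by the elementary conjunction lemma, which is no longer an item but THE PROOF
of the deciding theorem `closes : SettlingRobust → CensorshipRobust → ThirdLawRobust → MGHDExists →
FinalStateConjecture` (sorry-free, below): the two T2 devices it needs — the POINTED GAUGE
ENRICHMENT (one breathing-pullback coordinate along which the point value h_D(x₀)(v₀,v₀) has
non-zero derivative: injectivity AND immersion at c = 0; the construction of the proved support
GaugeEnrichment @0c79d3f2278a, kept as a settled edge) and the TAME PACKAGING (a compactly supported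
jointly smooth family through d is tame on the collared sole end of d: Literature
`InitialDataSet.isTameDataFamily_restrict_of_agree_off_compact_one`) — are proved INSIDE `closes`;
plain clause-wise codimension ≥ 1 does NOT assemble (PlanarNonClosure records the witness), robust
escapability does. Legend (inlined verbatim in every crux; d an admissible datum on X, 𝓓 =
admissibleVacuumData X): a TAME m-FAMILY THROUGH d is G : ℝᵐ → InitialDataSet with
IsSmoothDataFamily m G, G 0 = d, every G c ∈ 𝓓, and ONE compact K ⊆ X with G c = d (h and k
pointwise) off K for all c; G₁ : ℝⁿ → data ENRICHES G along an injective linear L : ℝᵐ → ℝⁿ if G₁ ∘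
L = G; a property Q of data is ROBUSTLY ESCAPABLE AT d if for every tame G through d there is a tame
enrichment G₁ of G such that for every tame enrichment G₂ : ℝᵖ → data of G₁ some open dense U ⊆ ℝᵖ
has ∀ v ∈ U ∃ δ > 0 ∀ 0 < |t| < δ, Q (G₂ (t • v)).
Lean: `CensorshipRobust ∧ SettlingRobust ∧ ThirdLawRobust ∧ MGHDExists`

## Assembly
THE DECIDING THEOREM `closes (hSettling : SettlingRobust) (hCensorship : CensorshipRobust)
(hThirdLaw : ThirdLawRobust) (hMGHD : MGHDExists) : FinalStateConjecture` IS PROVED (route-repair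
2026-08-17; one theorem, helpers as `have`; lean check rc 0, 0 sorries, axioms propext /
Classical.choice / Quot.sound, ≈103k heartbeats; imports
Literature.Geometry.Lorentzian.TameBreathingCurve + TameGenericityDiagonal). Fix X and an
exceptional admissible d (¬P d).
(1) CONJOIN CONCRETELY: the constant family G⁰ : ℝ⁰ → {d} is tame; CensorshipRobust applied to G⁰
gives G¹ ⊇ G⁰, SettlingRobust applied to G¹ gives G² ⊇ G¹, ThirdLawRobust applied to G² gives G³ ⊇
G².
(2) POINTED GAUGE: G⁴ q := (breathe (σ q_last))^*(G³ (init q)) on a breathing ball `ball z₀ 1`, ‖z₀‖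
= R+3, far out on the sole end e of d (Literature AFEnd.breatheFamily; joint smoothness
`contMDiff_breatheFamily_family_h/k`; admissibility by `isVacuumConstraintSolution_breatheFamily` +
`mem_admissibleVacuumData_of_agree_off_compact`; agreement with d off K ∪ breatheCore), L c := (c,
0) injective linear with G⁴ ∘ L = G³, x₀ := Φₑ z₀, v₀ := dΦₑ e₁ ≠ 0
(`injective_mfderiv_dataChartExt`), Λ(D) := h_D(x₀)(v₀,v₀); Λ(G⁴ q) = (1+σ(q_last))² h_{G³(init
q)}(x₀)(v₀,v₀) (`breatheFamily_h_inner_center`), where c ↦ h_{G³ c}(x₀)(v₀,v₀) = hCoeff e (G³ c) z₀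
e₁ e₁ is smooth (`contDiffAt_hCoeff_family`), so Λ ∘ G⁴ is C¹ with ∂_w(Λ ∘ G⁴)(0) = 2σ′(0)
h_d(x₀)(v₀,v₀) > 0.
(3) GENERAL POSITION: G⁴ enriches G¹, G², G³ along the composite linear maps, so the three
robustness clauses give open dense U_B, U_C, U_S ⊆ ℝ^{n+1}; U_Λ := {u : d(Λ∘G⁴)(0) u ≠ 0} is open
dense (v ↦ v + w/(k+1)); pick u in the fourfold intersection, escape radii δ_B, δ_C, δ_S, and δ_Λ on
which t ↦ Λ(G⁴(t u)) is strictly monotone (sign of the continuous derivative); ε := min.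
(4) THE WITNESS: H c := G⁴ (ρ(c₀) · u) with ρ(t) := (ε/2)·arctan t (|ρ| < ε, ρ injective, ρ(0) = 0,
ρ′(0) = ε/2): jointly smooth (`IsSmoothDataFamily.comp_contDiff`), H 0 = d, admissible, = d off the
compact K of G⁴, INJECTIVE (Λ-monotonicity below δ_Λ), IMMERSED at 0 (∂_{v′} h_{H c}(x₀)(v₀,v₀)|₀ =
d(Λ∘G⁴)(0)u · (ε/2) · v′₀ ≠ 0, chain rule), TAME on the collared end e.restrict (R+1)
(`isTameDataFamily_restrict_of_agree_off_compact_one`: same mass, wDist → 0), and for c ≠ 0 the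
clauses Q_B, Q_C, Q_S hold at H c (0 < |ρ(c₀)| < ε), hence with MGHDExists the full summit property
P (MGHD from hMGHD; complete 𝓘⁺ from Q_B; the decomposition with RaysStayInClosure, honest radii and
IsFutureOriented from Q_C; sub-extremality of ITS holes from Q_S). Since `FinalStateConjecture`
unfolds to `∀ X, IsTameChristodoulouGeneric (admissibleVacuumData X) P 1`, ⟨e.restrict _, H, …⟩ is
the witness it asks for. PlanarNonClosure and GaugeEnrichment are not used by `closes` (recorded
reason for the robust form / settled weaker edge).
History: the pre-T2 Assembly item (stmt-10135) was PROVED (assembly_proof @fef18d4702ce) against the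
old statement; after p126844 it was restated (stmt-17500) together with the T2 supports
PointedGaugeEnrichment (17501) and TameWitnessOfLocalFamily (17502); route-repair 2026-08-17 proved
their content inside `closes`, DROPPED the two supports, RESTATED the Assembly item 1:1 to the
crux-only shape `SettlingRobust → CensorshipRobust → ThirdLawRobust → MGHDExists →
FinalStateConjecture` (its proof is `closes`; an unproved support/assembly may not be a hypothesis
of the deciding theorem) and re-badged MGHDExists support→crux.

Rationale: WHY THIS LINE. The typed quantifier (`IsTameChristodoulouGeneric 𝓓 P 1` since re-type T2, p126844;
before it `IsChristodoulouGeneric`) is monotone in P but not closed under ∧ (card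
genericity-is-not-closed-under-and:
planar witness; contrast HuntSauerYorke1992 Fact 3″ and Baire), so every honest multi-clause proof
of this summit owes a JOINT
transversality statement; this route files the weakest clause-wise strengthening under which
assembly is a theorem: escapability in an
open dense set of radial directions of a finite-dimensional compactly supported probe, stable under
enrichment — walls, folds and normal
crossings all have it, and finite intersections of open dense sets are nonempty (general position,
imported from differential topology;
calculus is done diffeologically, along finite-dimensional smooth families only, so no topology on
the data space is needed). The shape
is read off the two places where strata of exceptional data ARE understood:
Christodoulou1999instability Thm 4.1 (2-planes Π_ϑ = escape
with a spare dimension) and AngelopoulosKehleUnger2026 Thm 2 (the extremal threshold is a C¹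
hypersurface and the final parameter ratio a
C¹ submersion, so one transverse direction enriches any probe and the chain rule keeps it transverse
in every further enrichment);
enrichments are compactly supported admissible deformations (localized gluing: CorvinoSchoen2003,
CarlottoSchoen2014, MaoOhTao2023;
gauge pullbacks as in Literature ConstraintFamilies.lean). Compact support is forced:
bury-at-infinity families (card
swallow-the-datum-genericity-escape) would otherwise falsify every robustness clause. No prior route
exists on this summit; the
negatives index is empty. RE-TYPE T2 (2026-08-16) is absorbed as follows: the new settling conjuncts
(RaysStayInClosure, honest near-zone radii, IsFutureOriented) are obligations of SettlingRobust's
Q_C (restated 1:1); TAMENESS of the witness family is free for this line precisely because its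
probes are compactly supported (collar the sole end of d beyond the support: same mass, wDist → 0 —
Literature TameFamilyOffCompact.lean) and IMMERSION at 0 comes from the pointed gauge coordinate
(the breathing construction already landed for GaugeEnrichment, with its functional exposed as the
point value h_D(x₀)(v₀,v₀)); since route-repair 2026-08-17 both are PROVED INSIDE the deciding
theorem `closes`, whose only hypotheses are the four cruxes.

RANKED CRUXES. #2 SettlingRobust (crux) — SETTLING IS ROBUSTLY ESCAPABLE (re-typed clause). Let
Q_C(D) := every maximal vacuum Cauchy development 𝒟 of D admits O and a FinalStateDecomposition dd
of 𝒟.toSpacetime O 2 with O = exteriorOf 𝒟 dd.charted, RaysStayInClosure 𝒟 O (every future-complete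
normalised null ray from Σ stays in closure O), HasExhaustiveCharts dd (honest growing radii Rᵢ ≥
max(r₊,0)+1, Rᵢ → ∞; near-zone C² convergence out to Rᵢ; O minus the certified late region causally
below the certified slab, for every chart time) and IsFutureOriented dd (orthochronous motions;
transported Kerr time vectors / ∂₀ eventually future-directed) — the summit's settling clause minus
sub-extremality. Claim: at EVERY admissible datum d (exceptional or not), Q_C is robustly escapable
in the sense of the Thesis legend. At good data this is cone-generic STABILITY of settling (it
contains nonlinear stability of the Kerr family under compactly supported perturbations:
KlainermanSzeftel2023, GiorgiKlainermanSzeftel2022 for |a| ≪ M, DafermosHolzegelRodnianskiTaylor2021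
for a = 0 in codimension 3, Hintz2026 claimed for the full subextremal range); at exceptional data
it says the non-settling strata are walls/folds in general position along tame probes (card item K1,
settling part). [difficulty: open-problem] (why it might fail: needs full-range Kerr stability AND
large-data capture, thin non-settling strata along EVERY tame probe, and now RaysStayInClosure — a
future-complete null ray from Σ inside the black hole off closure(d.o.c.) kills Q_C (retype REPORT
§5 Q1); a non-Kerr end state on an open cone or Cantor-laminated capture thresholds refute it.)
[Hintz2026, HafnerHintzVasy2025, KlainermanSzeftel2023, GiorgiKlainermanSzeftel2022,
DafermosHolzegelRodnianskiTaylor2021, DafermosLuk2017, arXiv:0811.0354]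
#3 CensorshipRobust (crux) — CENSORSHIP IS ROBUSTLY ESCAPABLE. Let Q_B(D) := every maximal vacuum
Cauchy development of D has complete future null infinity
(Summit.FinalStateConjecture.HasCompleteNullInfinity, Christodoulou's intrinsic sojourn form).
Claim: at every admissible datum d, Q_B is robustly escapable (Thesis legend): every tame probe G
through d enriches to a tame G₁ such that along every tame enrichment G₂ of G₁ an open dense set of
radial directions satisfies Q_B for all small t ≠ 0. This is weak cosmic censorship in
positive-codimension form, strengthened from 'one escaping curve' to 'the naked-singularity strata
are walls in general position in every compactly supported finite-dimensional probe, stably under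
enrichment' — the shape of Christodoulou1999instability Thm 4.1, whose 2-planes Π_ϑ = {ϑ + λ₁f₁ +
λ₂f₂} meet E only at ϑ (escape in EVERY direction of the plane, m = 2), now without symmetry and
inside admissibleVacuumData (card item K1, NS part). [difficulty: open-problem] (why it might fail:
Vacuum naked singularities exist (RSR 2023) and their instability is known only in symmetry or for
isolated self-similar profiles (Liu–Li, An 2025); thresholds accumulating from ONE side, or a Cantor
family of thresholds, defeat open-dense radial escape even where plain codimension 1 holds.)
[Christodoulou1999instability, LiuLi2018, LiLiu2022, An2025, RodnianskiShlapentokhRothman2023,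
Shlapentokhrothman2025, Christodoulou1999]
#4 ThirdLawRobust (crux) — THE THIRD LAW IS ROBUSTLY ESCAPABLE (extremality is a tame stratum). Let
Q_S(D) := for every maximal vacuum Cauchy development 𝒟 of D, every FinalStateDecomposition dd of
𝒟.toSpacetime on O = exteriorOf 𝒟 dd.charted with HasExhaustiveCharts dd has all holes sub-extremal
(Kerr.IsSubextremal (dd.mass i) (dd.spin i), i.e. |aᵢ| < Mᵢ). Claim: at every admissible datum d,
Q_S is robustly escapable (Thesis legend). Model theorem: AngelopoulosKehleUnger2026 Thm 2 — near
Reissner–Nordström in the spherically symmetric Einstein–Maxwell–scalar-field moduli space the set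
of asymptotically extremal black holes is a C¹ hypersurface and the final parameter ratio 𝒫_∞ a C¹
submersion; hence one transverse direction enriches any finite-dimensional probe, and by the chain
rule d(𝒫_∞ ∘ G₂)(0) ≠ 0 in EVERY further enrichment, which is exactly open-dense radial escape. The
crux asserts the same structure for the asymptotically-extremal-Kerr data of the vacuum problem
without symmetry (card item K1, EXT part; producer card third-law-transversality-injection supplies
the transverse 'spin-down packet' direction). Together with SettlingRobust it yields clause (ii) of
the summit with |aᵢ| < Mᵢ. [difficulty: open-problem] (why it might fail: In vacuum the
asymptotically-extremal set is not known to be C¹, closed, or a threshold; extremal horizons do form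
(KehleUnger2025) and AKU's C¹ structure is perturbative and spherically symmetric; a cusp or
one-sided accumulation of isologous leaves at |a| = M breaks open-dense escape.)
[AngelopoulosKehleUnger2026, KehleUnger2025, KehleUnger2024, AngelopoulosKehleUnger2024,
Dafermos2025, Aretakis2015]
#9 GaugeEnrichment (support) — GAUGE ENRICHMENT (injectivity device; provable). For every admissible
d and every tame family G : ℝᵐ → data through d there are a tame G₁ : ℝ^{m+1} → data enriching G
along an injective linear L, a direction w and a functional Λ on data with Λ ∘ G₁ of class C¹ and
fderiv (Λ ∘ G₁) 0 w ≠ 0. Construction: G₁(c, s) := ψ_s^*(G c) for diffeomorphisms ψ_s of X supported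
in a small chart ball around x₀, equal in the chart to y ↦ y + ρ(y)(e^{s̃} − 1)(y − y₀) with s̃ = κ
s/√(1+s²) (so ψ₀ = id, ψ_s(x₀) = x₀, Dψ_s(x₀) = e^{s̃}·id), and Λ(D) := h_D(x₀)(b, b): then Λ(G₁(c,
s)) = e^{2s̃}·h_{G c}(x₀)(b, b), smooth with ∂_s at 0 equal to 2κ h_d(x₀)(b,b) > 0. Admissibility,
constraints and compact support are preserved by compactly supported diffeomorphism pullback
(BartnikIsenberg2004 §2; the chart-domain version with three parameters is
Literature.Geometry.Lorentzian.InitialDataSet.exists_smoothFamily_constraints in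
ConstraintFamilies.lean). PROVED (gaugeEnrichment @0c79d3f2278a); its pointed form (Λ the point
value h_D(x₀)(v₀,v₀), giving injectivity AND immersion of the assembled curve) is re-proved inside
`closes`, so the item is a settled edge, not a hypothesis. [difficulty: L] [BartnikIsenberg2004,
Christodoulou1999]
#9 MGHDExists (crux, rank 9; re-badged support→crux by route-repair 2026-08-17: an unproved
load-bearing hypothesis of `closes` cannot stay support) — MGHD EXISTENCE (the anti-vacuity conjunct
of the summit; known theorem, not in tree). Every admissible datum D has a vacuum Cauchy development
𝒟 (typed Literature.Geometry.Lorentzian.VacuumCauchyDevelopment D) which is maximal (𝒟.IsMaximal: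
every vacuum Cauchy development of D embeds into it compatibly with the embeddings of X).
Choquet-Bruhat–Geroch 1969 (existence and uniqueness of the MGHD), Sbierski 2016 (dezornified
proof), Ringström 2009 Thm 16.6 / Ch. 23. Shared by every route of this summit; discharges the
conjunct (∃ MGHD) of the summit property for ALL admissible data, so that only clauses (B), (C), (S)
carry exceptional sets. [difficulty: XL] (why it might fail: a paper theorem (CBG 1969, Sbierski
2016) unproved in tree — only the undischarged Literature fact
choquetBruhat_geroch_exists_mghd_cauchy yields it; as TYPED, IsMaximal asks every
VacuumCauchyDevelopment.{u} — Ric = 0 under a HasLeviCivita binder, corrected Cauchy-hypersurface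
notion — to embed, so a typing slip in those structures, not physics, is what could falsify it.)
[ChoquetBruhatGeroch1969CMP, Sbierski2016AHP, Ringstrom2009]
#9 PlanarNonClosure (support) — NON-CLOSURE WITNESS (negative side; provable now; card item P1).
Curve-codimension ≥ 1 in the sense of the typed notion — through every point of E passes a smooth
injective entire curve γ : ℝ → ℝ² meeting E only at parameter 0 — is NOT closed under finite union:
E₁ = {0} and E₂ = ⋃_{n≥1} (Cₙ ∖ {pₙ}) (Cₙ the circle of radius 1/n about 0, pₙ = (1/n, 0)) both have
it (for q = (1/n)(cos θ, sin θ) ∈ E₂ use γ(c) = (eᶜ/n)(cos(θ b(c)), sin(θ b(c))) with a smooth bump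
b, b(0) = 1, b = 0 for |c| ≥ log(1 + 1/n)/2: |γ| is strictly increasing so γ is injective and meets
each C_m (m ≠ n) only on the positive x-axis, at p_m ∉ E₂), but E₁ ∪ E₂ has not: an injective curve
through 0 has |γ(c)| → 0 as c → 0±, so by the intermediate value theorem it meets every small Cₙ at
some c₊ > 0 and some c₋ < 0, both forced to equal pₙ — contradicting injectivity. This is why the
three clause cruxes carry the robust (enrichment-stable) form: comeagre and prevalent sets are
closed under countable intersection (Baire; HuntSauerYorke1992 Fact 3″), Christodoulou's typed
notion is not. [difficulty: provable-now] [HuntSauerYorke1992, Christodoulou1999, Christodoulou2008]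

TWO-LAYER PLAN. Foreseen glued splits (k = 2, depth 1, filed only after a crux closes or a prover
asks): each clause crux C_Q ⇐ LocalStructure_Q →
Enrichment_Q → C_Q, where LocalStructure_Q says the Q-exceptional set is, along every tame probe
through d, contained near 0 in finitely
many C¹ wall / C² fold zero sets (the physics: instability of naked singularities without symmetry
for B; full-range Kerr stability and
capture for C; a C¹ asymptotically-extremal threshold in vacuum for S), and Enrichment_Q says
compactly supported admissible deformations
realising the transverse directions exist through every admissible datum (localized gluing
CorvinoSchoen2003 / CarlottoSchoen2014 /
MaoOhTao2023 at data without KIDs on the gluing annulus; gauge directions elsewhere). ThirdLawRobust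
may first be split by regime:
near-Kerr data (AKU-type C¹ submersion of the final parameter ratio) vs far data. The analytic
kernel (open-dense intersection,
arctan reparametrisation, `IsSmoothDataFamily` composition, immersion chain rule), the
END-RESTRICTION packaging and the
pointed gauge all live inside the proved deciding theorem `closes`; nothing of them is an item.

KILL CRITERIA. (i) A refutation of any of the three robust cruxes by a ONE-SIDED ACCUMULATION or
CANTOR-LAMINATION witness inside admissibleVacuumData
(the (−) branch of card threshold-lamination-vs-curve-genericity made rigorous, or critical-collapse
fine structure proven to give
thresholds accumulating at a smooth admissible datum) closes the route `refuted:<Decl>`: the line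
has no repair inside Christodoulou's
register (hand the witness to prevalence-universal-pulse-probe, whose register is closed under ∩).
(ii) A non-Kerr asymptotic end state
(hairy / time-periodic / soliton) on an open cone of tame directions refutes SettlingRobust and the
summit itself. (iii) If
swallow-the-datum-genericity-escape's burial families turned out to be legend-TAME (compact support
not stopping burial), all three cruxes would be
trivially true and the route would degenerate to MGHDExists + the proved `closes` — route moot
(close `superseded`), not refuted; re-type T2 has meanwhile retightened the
summit itself (burial is not IsTameDataFamily: mass continuity, retype REPORT P2), so (iii) now
needs a burial that is BOTH compactly supported and tame. (iv) A direct proof of FSC elsewhere moots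
the route; proofs of
clause genericity in plain (non-robust) form do NOT moot it — they need this conjunction lemma
(`closes`) or another joint-transversality device.

NOT DECOMPOSED YET. Deliberately not decomposed at open: the wall/fold LOCAL STRUCTURE of each
exceptional set versus the EXISTENCE OF ENRICHMENTS
(compactly supported admissible multi-parameter deformations; KID obstructions on the gluing region;
uniform-in-c admissibility via a
bounded reparametrisation c ↦ κc/√(1+|c|²)) — these are the layer-2 children above; the regime split
of ThirdLawRobust (near-Kerr vs
far); the diffeomorphism-invariance of Q_B, Q_C, Q_S (needed by provers of the cruxes to dispose of
gauge directions, not by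
`closes`); constants (escape radii δ, probe dimensions) are existential throughout and never fixed.

CHEAPEST FALSIFIER. (1) Typed-vacuity check a refuter can run in an hour: does the burial
construction of card swallow-the-datum-genericity-escape survive
the compact-support clause of TAME (one compact K for all parameters c)? If a tame family can still
hide a datum, the cruxes are trivially
true and the summit's typing is degenerate (Kill (iii)). (2) Literature check: is there a rigorous
example, in any Einstein-matter model,
of black-hole/naked-singularity thresholds p*_n accumulating from one side at a smooth datum
(critical-collapse fine structure)? One such
example inside an admissible class is the template refutation of CensorshipRobust. (3) Lean: the
conjunction lemma itself — if it did not prove, the typing of the legend would be wrong. DONE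
(route-repair 2026-08-17): `closes : SettlingRobust → CensorshipRobust → ThirdLawRobust → MGHDExists
→ FinalStateConjecture` elaborates crux-only and sorry-free against the re-typed Statement (planner
glue_c.lean (Sketch3.lean long form), lean check rc 0, axioms propext / Classical.choice /
Quot.sound, ≈103k heartbeats), with the pointed gauge, the tame packaging and the immersion chain
rule inside the proof; what remains provable-now is PlanarNonClosure only.

NUMBERS. Known strata structure the cruxes are measured against: Christodoulou1999instability Thm
4.1 — 2-planes Π_ϑ through each exceptional
ϑ ∈ BV ∩ L¹ with (Π_ϑ ∖ {ϑ}) ∩ E = ∅ (m = 2, escape in every direction);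
DafermosHolzegelRodnianskiTaylor2021 — codimension-3 'submanifold'
of data asymptoting to Schwarzschild (shooting; no regularity); AngelopoulosKehleUnger2026 Thm 2 —
C¹ codimension-1 extremal threshold,
C¹ isologous foliation σ ∈ [−1,1], Aretakis instability generic on a C¹ codimension-2 subset
(§1.1.5); HuntSauerYorke1992 Fact 3″ —
prevalence closed under countable ∩; Baire — comeagre closed under countable ∩. Items at open: 7 (3
crux, 3 support, 1 assembly); after route-repair T2: 9 (3 crux, 5 support — GaugeEnrichment proved
—, 1 assembly); after route-repair 2026-08-17 (crux-only deciding theorem): 7 (4 crux = 3 clause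
cruxes + MGHDExists r9; 2 support = GaugeEnrichment proved, PlanarNonClosure; 1 assembly restated to
the crux-only shape, whose proof is the proved glue `closes`).

DEFINITION REQUESTS. None filed at open: TAME family, ENRICHMENT and ROBUST ESCAPABILITY are inlined
(let-bound) in each crux so that every signature
elaborates today (lean check rc 0). If the route survives its first refutation pass, request
`InitialDataSet.IsTameFamilyThrough 𝓓 d m G`
and `InitialDataSet.RobustlyEscapableAt 𝓓 Q d` in Literature/Geometry/Lorentzian/Genericity.lean and
restate the three cruxes 1:1 over
them (same meaning, shorter docstrings). No cite facts are imported as hypotheses (MGHD existence is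
a crux item, not a vendored fact).

Novelty: Searches (2026-08-15): `lit frontier FinalStateConjecture --since 2021` (30 rows; relevant:
arXiv:2601.01517 multi-black-hole Cauchy data
with prescribed ADM parameters, arXiv:2112.07183; nothing on the algebra of genericity); `lit
bridges FinalStateConjecture --cross any` (30
rows, surveys only); `lit galaxy search "codimension of the exceptional set of initial data cosmic
censorship genericity" --star all` (0),
`"positive codimension" --star all` (20, none in GR), `"instability of naked singularities" --star
all` (5 books: Joshi, Wald (ed.),
Ashtekar (ed.), Rendall, Anel–Catren; in-book grep of Wald (ed.) for "codimension"/"generic initial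
data": 0); `lit search --source zbmath
"naked singularities instability scalar field Christodoulou"` (8: doi:10.2307/121023, LiuLi2018,
LiLiu2022, An2025, arXiv:2210.11325,
arXiv:2605.16235, arXiv:2402.16250, arXiv:2402.00062); `lit search --source zbmath "Kehle Unger
extremal black holes"` (5: arXiv:2410.16234,
arXiv:2603.10378, arXiv:2402.10190, arXiv:2211.15742, arXiv:2411.17938); `lit read arxiv:2603.10378`
pp. 2–9 (Thm 2, Remarks 5–6, §1.1.5);
`lit search --hybrid --no-graph "genericity positive codimension exceptional set cosmic censorship
families of initial data"` (10 held docs, vector leg: Ashtekar (ed.) 2015, Valiente Kroon 2016/2022,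
Rendall 2008 pp. 286–295 — genericity as an ASSUMPTION of censorship statements, no algebra of the
notion — Wald 1984, Klainerman–Szeftel 2020); Genericity.lean / ConstraintFamilies.lean / Statemen  [refs: 10.2307/121023, 2601.01517, 2112.07183, 2210.11325, 2605.16235, 2402.16250, 2402.00062, 2410.16234, 2603.10378, 2402.10190, 2211.15742, 2411.17938, doi:10.2307/121023, arxiv:2603.10378, LiuLi2018, LiLiu2022, An2025, AngelopoulosKehleUnger2026, DafermosHolzegelRodnianskiTaylor2021, HuntSauerYorke1992]

Barriers (technique_class: statement-structure, transversality, genericity-algebra): - technique_class: statement-structure, transversality, genericity-algebra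
- Literature.Barriers.FinalStateConjecture.AretakisInstability: bites on SettlingRobust only at
exactly extremal admissible data IF generic tame perturbations stayed asymptotically extremal; the
bet (ThirdLawRobust, after AngelopoulosKehleUnger2026 §1.1.5: Aretakis growth is generic only on a
codimension-2 subset INSIDE the codimension-1 threshold) is that open-dense directions leave the
threshold, so the C² convergence demanded is to a sub-extremal Kerr, where no horizon instability
acts; AretakisInstabilityNarrow likewise.
- Literature.Barriers.FinalStateConjecture.SlowlyRotatingKerrFrontier: it does not evade it by
technique; the bet is full sub-extremal-range nonlinear Kerr stability, which SettlingRobust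
contains at Kerr data and inherits as its rank-2 difficulty. Frontier refresh (2026-08-15, asked for
by the retriage pass): Hintz2026 (arXiv:2606.28253 v2, p. 1, unrefereed, 509 pp. + two companions)
claims global nonlinear stability of the FULL subextremal Kerr family (data close to subextremal
Kerr with a finite r^{-z}(log r)^k expansion, z > 1, plus an O(r^{-3-ε₀}) remainder; generalized
wave-map gauge, Nash–Moser), on top of HafnerHintzVasy2025 (arXiv:2506.21183, linear stability on
the full subextremal range). If confirmed, the printed reach this barrier records
(KlainermanSzeftel2023 / GiorgiKlainermanSzeftel2022, |a| ≪ M; barrier decl status 'established' is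
about that printed reach and sta

History (route lifecycle, newest last):
- 2026-08-16T23:20:43Z · rev 5: restated SettlingRobust (stmt-FinalStateConjecture-10130), Assembly (stmt-FinalStateConjecture-10135 proved) — route-repair (statement revised p126844, re-type T2): SettlingRobust restated 1:1 (Q_C gains RaysStayInClosure + IsFutureOriented; HasExhaustiveCharts honest ra (planner-rrepair-FinalStateConjecture-RobustCla-4778cc57-0)
- 2026-08-17T00:29:23Z · rev 7: restated Assembly (stmt-FinalStateConjecture-17500) — route-repair (glue.non-crux-hypothesis), step 2/2: CRUX-ONLY DECIDING THEOREM. closes : SettlingRobust → CensorshipRobust → ThirdLawRobust → MGHDExists → FinalS (planner-rbadge-FinalStateConjecture-RobustClau-a4b6f4d9-0)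
- 2026-08-17T00:29:23Z · rev 7: dropped stmt-FinalStateConjecture-17501, stmt-FinalStateConjecture-17502 — route-repair (glue.non-crux-hypothesis), step 2/2: CRUX-ONLY DECIDING THEOREM. closes : SettlingRobust → CensorshipRobust → ThirdLawRobust → MGHDExists → FinalS (planner-rbadge-FinalStateConjecture-RobustClau-a4b6f4d9-0)
- 2026-08-26T14:59:54Z · DORMANT — reconciler: no traction for 6.5 d (last activity item-proof-filed at 2026-08-20T01:53:04Z); parked, not closed — `ledger route dormant route-FinalStateConjectur (operator:999:3764839)
- 2026-08-30T17:10:03Z · REACTIVATED (open) — reconciler: reactivated — activity statement-checked at 2026-08-30T15:54:01Z after parking at 2026-08-26T14:59:54Z (operator:999:538689)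
- 2026-09-04T19:05:16Z · DORMANT — reconciler: no traction for 5 d (last activity statement-checked at 2026-08-30T17:45:39Z); parked, not closed — `ledger route dormant route-FinalStateConjecture (operator:999:2437326)

sub-problem: FinalStateConjecture · status: dormant · opened planner-plancard-FinalStateConjecture-FinalSt-2854f18f-0 2026-08-15T15:12:42Z · rev 7 · ledger route-FinalStateConjecture-RobustClausewiseGenericity
GENERATED by the gate from the ledger (D-0016/17). Provers cite these decls: `theorem foo : Summit.FinalStateConjecture.FinalStateConjecture.Theses.RobustClausewiseGenericity.<Decl> := …` in Summits/FinalStateConjecture/FinalStateConjecture/Theorems/<Name>.lean.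
-/

namespace Summit.FinalStateConjecture.FinalStateConjecture.Theses.RobustClausewiseGenericity

open scoped BigOperators Topology Manifold Classical MeasureTheory ProbabilityTheory Matrix InnerProductSpace ComplexConjugate ContinuousMap
open Filter Set Function TopologicalSpace MeasureTheory

attribute [summit_statement] _root_.FinalStateConjecture

-- earlier SettlingRobust (stmt-FinalStateConjecture-10130, replaced 2026-08-16T23:20:43Z -> stmt-FinalStateConjecture-17499): retired by None — ∀ (X : Type) [TopologicalSpace X] [ChartedSpace Literature.Geometry.Lorentzian.E3 X] [IsManifold (𝓡 3) ((⊤ : ℕ∞) : WithTop ℕ∞) X] [T2Space X] [SecondCountableTopology X] [ConnectedSpace X], ∀ d ∈ Literature.Geometry.Lorentzian.admissibleVacuumData X, let Tam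
/-- item stmt-FinalStateConjecture-17499 · crux · rank 2 · open · by planner
why it might fail: Needs full-range Kerr stability + large-data capture (Hintz2026: near-Kerr, unrefereed), thin non-settling strata along EVERY tame probe, and now RaysStayInClosure: one future-complete null ray from Σ in the black hole off closure(d.o.c.) kills Q_C. Non-Kerr end states on an open cone refute it.
sources: Hintz2026, HafnerHintzVasy2025, KlainermanSzeftel2023, GiorgiKlainermanSzeftel2022, DafermosHolzegelRodnianskiTaylor2021, DafermosLuk2017
[crux] SETTLING IS ROBUSTLY ESCAPABLE (re-typed settling clause, statement revision T2 / p126844).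
Let Q_C(D) := every maximal vacuum Cauchy development 𝒟 of D admits O and a FinalStateDecomposition
dd of 𝒟.toSpacetime on O in C² with O = exteriorOf 𝒟 dd.charted, RaysStayInClosure 𝒟 O (every
future-complete normalised null ray from Σ stays in closure O — the settled region is not the
witness's to choose), HasExhaustiveCharts dd (honest growing near-zone radii Rᵢ(τ) ≥ max(r₊,0)+1, Rᵢ
→ ∞, near-zone C² convergence out to Rᵢ, and for every chart time τ₁ > τ₀ every point of O outside
the certified late region lies in the causal past of the certified slab) and IsFutureOriented dd
(orthochronous motions; the transported Kerr time vectors Λᵢ V_{Mᵢ,aᵢ} and ∂₀ are eventually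
future-directed causal) — i.e. the summit's settling clause minus sub-extremality (|aᵢ| ≤ Mᵢ as the
structure allows). Claim: at EVERY admissible datum d (exceptional or not), Q_C is robustly
escapable in the sense of the Thesis legend (a TAME m-family through d: IsSmoothDataFamily, G 0 = d,
admissible members, = d (h and k pointwise) off ONE compact K; enrichment along injective linear
maps; for every tame probe G thro -/
@[route_item "route-FinalStateConjecture-RobustClausewiseGenericity"]
def SettlingRobust : Prop :=
  ∀ (X : Type) [TopologicalSpace X] [ChartedSpace Literature.Geometry.Lorentzian.E3 X] [IsManifold (𝓡 3) ((⊤ : ℕ∞) : WithTop ℕ∞) X] [T2Space X] [SecondCountableTopology X] [ConnectedSpace X], ∀ d ∈ Literature.Geometry.Lorentzian.admissibleVacuumData X, let Tame : (m : ℕ) → (EuclideanSpace ℝ (Fin m) → Literature.Geometry.Lorentzian.InitialDataSet (𝓡 3) X) → Prop := fun m G ↦ Literature.Geometry.Lorentzian.InitialDataSet.IsSmoothDataFamily m G ∧ G 0 = d ∧ (∀ c, G c ∈ Literature.Geometry.Lorentzian.admissibleVacuumData X) ∧ ∃ K : Set X, IsCompact K ∧ ∀ c, ∀ x ∉ K,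 (G c).h.inner x = d.h.inner x ∧ (G c).k x = d.k x; let Q : Literature.Geometry.Lorentzian.InitialDataSet (𝓡 3) X → Prop := fun D ↦ ∀ 𝒟 : Literature.Geometry.Lorentzian.VacuumCauchyDevelopment D, 𝒟.IsMaximal → ∃ (O : Set 𝒟.carrier) (dd : Literature.Geometry.Lorentzian.FinalStateDecomposition 𝒟.toSpacetime O 2), O = Summit.FinalStateConjecture.exteriorOf 𝒟.toCauchyDevelopment dd.charted ∧ Summit.FinalStateConjecture.RaysStayInClosure 𝒟.toCauchyDevelopment O ∧ Summit.FinalStateConjecture.HasExhaustiveCharts dd ∧ Summit.FinalStateConjecture.IsFutureOriented dd; ∀ (m : ℕ) (G : EuclideanSpace ℝ (Fin m) → Literature.Geometry.Lorentzian.InitialDataSet (𝓡 3) X), Tame m G → ∃ (n : ℕ) (G₁ : EuclideanSpace ℝ (Fin n) → Literature.Geometry.Lorentzian.InitialDataSet (𝓡 3) X) (L : EuclideanSpace ℝ (Fin m) →ₗ[ℝ] EuclideanSpace ℝ (Fin n)), Function.Injective L ∧ Tame n G₁ ∧ (∀ c, G₁ (L c) = G c) ∧ ∀ (p : ℕ)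 (G₂ : EuclideanSpace ℝ (Fin p) → Literature.Geometry.Lorentzian.InitialDataSet (𝓡 3) X) (L' : EuclideanSpace ℝ (Fin n) →ₗ[ℝ] EuclideanSpace ℝ (Fin p)), Function.Injective L' → Tame p G₂ → (∀ c, G₂ (L' c) = G₁ c) → ∃ U : Set (EuclideanSpace ℝ (Fin p)), IsOpen U ∧ Dense U ∧ ∀ v ∈ U, ∃ δ : ℝ, 0 < δ ∧ ∀ t : ℝ, t ≠ 0 → |t| < δ → Q (G₂ (t • v))

/-- item stmt-FinalStateConjecture-10131 · crux · rank 3 · open · by planner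
why it might fail: Vacuum naked singularities exist (RSR2023); no instability theorem outside symmetry (LiuLi2018, An2025: symmetric/profile-specific); instability is regularity-dependent: Christodoulou's C^{1,a} examples are STABLE on an open Hölder set (Zheng2026). One-sided/Cantor threshold accumulation kills it.
sources: Christodoulou1999instability, Zheng2026, arXiv:2605.16095, RodnianskiShlapentokhRothman2023, ShlapentokhRothman2022, LiuLi2018
[crux] CENSORSHIP IS ROBUSTLY ESCAPABLE. Let Q_B(D) := every maximal vacuum Cauchy development of D
has complete future null infinity (Summit.FinalStateConjecture.HasCompleteNullInfinity,
Christodoulou's intrinsic sojourn form). Claim: at every admissible datum d, Q_B is robustly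
escapable (Thesis legend): every tame probe G through d enriches to a tame G₁ such that along every
tame enrichment G₂ of G₁ an open dense set of radial directions satisfies Q_B for all small t ≠ 0.
This is weak cosmic censorship in positive-codimension form, strengthened from 'one escaping curve'
to 'the naked-singularity strata are walls in general position in every compactly supported
finite-dimensional probe, stably under enrichment' — the shape of Christodoulou1999instability Thm
4.1, whose 2-planes Π_ϑ = {ϑ + λ₁f₁ + λ₂f₂} meet E only at ϑ (escape in EVERY direction of the
plane, m = 2), now without symmetry and inside admissibleVacuumData (card item K1, NS part).
[difficulty: open-problem] -/
@[route_item "route-FinalStateConjecture-RobustClausewiseGenericity"]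
def CensorshipRobust : Prop :=
  ∀ (X : Type) [TopologicalSpace X] [ChartedSpace Literature.Geometry.Lorentzian.E3 X] [IsManifold (𝓡 3) ((⊤ : ℕ∞) : WithTop ℕ∞) X] [T2Space X] [SecondCountableTopology X] [ConnectedSpace X], ∀ d ∈ Literature.Geometry.Lorentzian.admissibleVacuumData X, let Tame : (m : ℕ) → (EuclideanSpace ℝ (Fin m) → Literature.Geometry.Lorentzian.InitialDataSet (𝓡 3) X) → Prop := fun m G ↦ Literature.Geometry.Lorentzian.InitialDataSet.IsSmoothDataFamily m G ∧ G 0 = d ∧ (∀ c, G c ∈ Literature.Geometry.Lorentzian.admissibleVacuumData X) ∧ ∃ K : Set X, IsCompact K ∧ ∀ c, ∀ x ∉ K, (G c).h.inner x = d.h.inner x ∧ (G c).k x = d.k x; let Q : Literature.Geometry.Lorentzian.InitialDataSet (𝓡 3) X → Prop := fun D ↦ ∀ 𝒟 : Literature.Geometry.Lorentzian.VacuumCauchyDevelopment D, 𝒟.IsMaximal → Summit.FinalStateConjecture.HasCompleteNullInfinity 𝒟.toCauchyDevelopment; ∀ (m : ℕ) (G : EuclideanSpace ℝ (Fin m) →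 Literature.Geometry.Lorentzian.InitialDataSet (𝓡 3) X), Tame m G → ∃ (n : ℕ) (G₁ : EuclideanSpace ℝ (Fin n) → Literature.Geometry.Lorentzian.InitialDataSet (𝓡 3) X) (L : EuclideanSpace ℝ (Fin m) →ₗ[ℝ] EuclideanSpace ℝ (Fin n)), Function.Injective L ∧ Tame n G₁ ∧ (∀ c, G₁ (L c) = G c) ∧ ∀ (p : ℕ) (G₂ : EuclideanSpace ℝ (Fin p) → Literature.Geometry.Lorentzian.InitialDataSet (𝓡 3) X) (L' : EuclideanSpace ℝ (Fin n) →ₗ[ℝ] EuclideanSpace ℝ (Fin p)), Function.Injective L' → Tame p G₂ → (∀ c, G₂ (L' c) = G₁ c) → ∃ U : Set (EuclideanSpace ℝ (Fin p)), IsOpen U ∧ Dense U ∧ ∀ v ∈ U, ∃ δ : ℝ, 0 < δ ∧ ∀ t : ℝ, t ≠ 0 → |t| < δ → Q (G₂ (t • v))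

/-- item stmt-FinalStateConjecture-10132 · crux · rank 4 · open · by planner
why it might fail: In vacuum the asymptotically-extremal set is not known C^1, closed or thin; extremal Kerr formation is only conjectured (KehleUnger2025 §1); AKU2026's C^1 threshold is perturbative, spherical, EMSF. An open cone of extremal directions, a cusp, or one-sided accumulation of leaves at |a|=M breaks it.
sources: AngelopoulosKehleUnger2026, KehleUnger2025, KehleUnger2024, AngelopoulosKehleUnger2024, arXiv:2304.08455, Dafermos2025
[crux] THE THIRD LAW IS ROBUSTLY ESCAPABLE (extremality is a tame stratum). Let Q_S(D) := for every
maximal vacuum Cauchy development 𝒟 of D, every FinalStateDecomposition dd of 𝒟.toSpacetime on O =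
exteriorOf 𝒟 dd.charted with HasExhaustiveCharts dd has all holes sub-extremal (Kerr.IsSubextremal
(dd.mass i) (dd.spin i), i.e. |aᵢ| < Mᵢ). Claim: at every admissible datum d, Q_S is robustly
escapable (Thesis legend). Model theorem: AngelopoulosKehleUnger2026 Thm 2 — near Reissner–Nordström
in the spherically symmetric Einstein–Maxwell–scalar-field moduli space the set of asymptotically
extremal black holes is a C¹ hypersurface and the final parameter ratio 𝒫_∞ a C¹ submersion; hence
one transverse direction enriches any finite-dimensional probe, and by the chain rule d(𝒫_∞ ∘ G₂)(0)
≠ 0 in EVERY further enrichment, which is exactly open-dense radial escape. The crux asserts the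
same structure for the asymptotically-extremal-Kerr data of the vacuum problem without symmetry
(card item K1, EXT part; producer card third-law-transversality-injection supplies the transverse
'spin-down packet' direction). Together with SettlingRobust it yields clause (ii) of the summit with
|aᵢ| < Mᵢ. [diffi -/
@[route_item "route-FinalStateConjecture-RobustClausewiseGenericity"]
def ThirdLawRobust : Prop :=
  ∀ (X : Type) [TopologicalSpace X] [ChartedSpace Literature.Geometry.Lorentzian.E3 X] [IsManifold (𝓡 3) ((⊤ : ℕ∞) : WithTop ℕ∞) X] [T2Space X] [SecondCountableTopology X] [ConnectedSpace X], ∀ d ∈ Literature.Geometry.Lorentzian.admissibleVacuumData X, let Tame : (m : ℕ) → (EuclideanSpace ℝ (Fin m) → Literature.Geometry.Lorentzian.InitialDataSet (𝓡 3) X) → Prop := fun m G ↦ Literature.Geometry.Lorentzian.InitialDataSet.IsSmoothDataFamily m G ∧ G 0 = d ∧ (∀ c, G c ∈ Literature.Geometry.Lorentzian.admissibleVacuumData X) ∧ ∃ K : Set X, IsCompact K ∧ ∀ c, ∀ x ∉ K, (G c).h.inner x = d.h.inner x ∧ (G c).k x = d.k x; let Q : Literature.Geometry.Lorentzian.InitialDataSet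 (𝓡 3) X → Prop := fun D ↦ ∀ 𝒟 : Literature.Geometry.Lorentzian.VacuumCauchyDevelopment D, 𝒟.IsMaximal → ∀ (O : Set 𝒟.carrier) (dd : Literature.Geometry.Lorentzian.FinalStateDecomposition 𝒟.toSpacetime O 2), O = Summit.FinalStateConjecture.exteriorOf 𝒟.toCauchyDevelopment dd.charted → Summit.FinalStateConjecture.HasExhaustiveCharts dd → ∀ i, Literature.Geometry.Lorentzian.Kerr.IsSubextremal (dd.mass i) (dd.spin i); ∀ (m : ℕ) (G : EuclideanSpace ℝ (Fin m) → Literature.Geometry.Lorentzian.InitialDataSet (𝓡 3) X), Tame m G → ∃ (n : ℕ) (G₁ : EuclideanSpace ℝ (Fin n) → Literature.Geometry.Lorentzian.InitialDataSet (𝓡 3) X) (L : EuclideanSpace ℝ (Fin m) →ₗ[ℝ] EuclideanSpace ℝ (Fin n)), Function.Injective L ∧ Tame n G₁ ∧ (∀ c, G₁ (L c) = G c) ∧ ∀ (p : ℕ) (G₂ : EuclideanSpace ℝ (Fin p) → Literature.Geometry.Lorentzian.InitialDataSet (𝓡 3) X) (L' : EuclideanSpace ℝ (Fin n) →ₗ[ℝ]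 EuclideanSpace ℝ (Fin p)), Function.Injective L' → Tame p G₂ → (∀ c, G₂ (L' c) = G₁ c) → ∃ U : Set (EuclideanSpace ℝ (Fin p)), IsOpen U ∧ Dense U ∧ ∀ v ∈ U, ∃ δ : ℝ, 0 < δ ∧ ∀ t : ℝ, t ≠ 0 → |t| < δ → Q (G₂ (t • v))

/-- item stmt-FinalStateConjecture-9937 · crux · rank 9 · open · by planner
why it might fail: Paper theorem (CBG 1969, Sbierski 2016), unproved in tree (= undischarged fact choquetBruhat_geroch_exists_mghd_cauchy; XL). As typed, IsMaximal asks EVERY VacuumCauchyDevelopment.{u} (Ric=0 under a HasLeviCivita binder, corrected Cauchy hypersurface) to embed: a typing slip there could falsify it.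
sources: ChoquetBruhatGeroch1969CMP, Sbierski2016AHP, Ringstrom2009
[support] every admissible datum has a maximal globally hyperbolic vacuum development, stated over
the repaired structure `VacuumCauchyDevelopment` (the corrected form of the deprecated
`choquetBruhat_geroch_exists_mghd`, recorded in `CauchyProblemExistenceDefect`);
Choquet-Bruhat–Geroch 1969 Thm. 3, Sbierski 2016 Thm. 2.6. Known theorem; large formalisation;
shared by every route of this summit. [difficulty: XL] -/
@[route_item "route-FinalStateConjecture-RobustClausewiseGenericity"]
def MGHDExists : Prop :=
  ∀ (X : Type) [TopologicalSpace X] [ChartedSpace Literature.Geometry.Lorentzian.E3 X] [IsManifold (𝓡 3) ((⊤ : ℕ∞) : WithTop ℕ∞) X] [T2Space X] [SecondCountableTopology X] [ConnectedSpace X], ∀ D ∈ Literature.Geometry.Lorentzian.admissibleVacuumData X, ∃ 𝒟 : Literature.Geometry.Lorentzian.VacuumCauchyDevelopment D, 𝒟.IsMaximal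

/-- item stmt-FinalStateConjecture-10133 · support · rank 9 · closed · proved by Summit.FinalStateConjecture.FinalStateConjecture.Theorems.RobustClausewiseGenericity.gaugeEnrichment @ e6d7672f9ace (prover) · by planner
sources: BartnikIsenberg2004, Christodoulou1999
[support] GAUGE ENRICHMENT (injectivity device; provable). For every admissible d and every tame
family G : ℝᵐ → data through d there are a tame G₁ : ℝ^{m+1} → data enriching G along an injective
linear L, a direction w and a functional Λ on data with Λ ∘ G₁ of class C¹ and fderiv (Λ ∘ G₁) 0 w ≠
0. Construction: G₁(c, s) := ψ_s^*(G c) for diffeomorphisms ψ_s of X supported in a small chart ball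
around x₀, equal in the chart to y ↦ y + ρ(y)(e^{s̃} − 1)(y − y₀) with s̃ = κ s/√(1+s²) (so ψ₀ = id,
ψ_s(x₀) = x₀, Dψ_s(x₀) = e^{s̃}·id), and Λ(D) := h_D(x₀)(b, b): then Λ(G₁(c, s)) = e^{2s̃}·h_{G
c}(x₀)(b, b), smooth with ∂_s at 0 equal to 2κ h_d(x₀)(b,b) > 0. Admissibility, constraints and
compact support are preserved by compactly supported diffeomorphism pullback (BartnikIsenberg2004
§2; the chart-domain version with three parameters is
Literature.Geometry.Lorentzian.InitialDataSet.exists_smoothFamily_constraints in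
ConstraintFamilies.lean). Used by the Assembly to make the assembled one-parameter family injective
(t ↦ Λ is strictly monotone along directions with dΛ ≠ 0, an open dense set). [difficulty: L] -/
@[route_item "route-FinalStateConjecture-RobustClausewiseGenericity"]
def GaugeEnrichment : Prop :=
  ∀ (X : Type) [TopologicalSpace X] [ChartedSpace Literature.Geometry.Lorentzian.E3 X] [IsManifold (𝓡 3) ((⊤ : ℕ∞) : WithTop ℕ∞) X] [T2Space X] [SecondCountableTopology X] [ConnectedSpace X], ∀ d ∈ Literature.Geometry.Lorentzian.admissibleVacuumData X, let Tame : (m : ℕ) → (EuclideanSpace ℝ (Fin m) → Literature.Geometry.Lorentzian.InitialDataSet (𝓡 3) X) → Prop := fun m G ↦ Literature.Geometry.Lorentzian.InitialDataSet.IsSmoothDataFamily m G ∧ G 0 = d ∧ (∀ c, G c ∈ Literature.Geometry.Lorentzian.admissibleVacuumData X) ∧ ∃ K : Set X, IsCompact K ∧ ∀ c, ∀ x ∉ K, (G c).h.inner x = d.h.inner x ∧ (G c).k x = d.k x; ∀ (m : ℕ) (G : EuclideanSpace ℝ (Fin m) → Literature.Geometry.Lorentzian.InitialDataSet (𝓡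 3) X), Tame m G → ∃ (G₁ : EuclideanSpace ℝ (Fin (m + 1)) → Literature.Geometry.Lorentzian.InitialDataSet (𝓡 3) X) (L : EuclideanSpace ℝ (Fin m) →ₗ[ℝ] EuclideanSpace ℝ (Fin (m + 1))) (w : EuclideanSpace ℝ (Fin (m + 1))) (Λ : Literature.Geometry.Lorentzian.InitialDataSet (𝓡 3) X → ℝ), Function.Injective L ∧ Tame (m + 1) G₁ ∧ (∀ c, G₁ (L c) = G c) ∧ ContDiff ℝ 1 (Λ ∘ G₁) ∧ fderiv ℝ (Λ ∘ G₁) 0 w ≠ 0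

-- `GaugeEnrichment` holds: proved by `Summit.FinalStateConjecture.FinalStateConjecture.Theorems.RobustClausewiseGenericity.gaugeEnrichment` @ e6d7672f9ace (its module imports this route file, so no `_holds` link can be stated here).

/-- item stmt-FinalStateConjecture-10134 · support · rank 9 · open · by planner
sources: HuntSauerYorke1992, Christodoulou1999, Christodoulou2008
[support] NON-CLOSURE WITNESS (negative side; provable now; card item P1). Curve-codimension ≥ 1 in
the sense of the typed notion — through every point of E passes a smooth injective entire curve γ :
ℝ → ℝ² meeting E only at parameter 0 — is NOT closed under finite union: E₁ = {0} and E₂ = ⋃_{n≥1}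
(Cₙ ∖ {pₙ}) (Cₙ the circle of radius 1/n about 0, pₙ = (1/n, 0)) both have it (for q = (1/n)(cos θ,
sin θ) ∈ E₂ use γ(c) = (eᶜ/n)(cos(θ b(c)), sin(θ b(c))) with a smooth bump b, b(0) = 1, b = 0 for
|c| ≥ log(1 + 1/n)/2: |γ| is strictly increasing so γ is injective and meets each C_m (m ≠ n) only
on the positive x-axis, at p_m ∉ E₂), but E₁ ∪ E₂ has not: an injective curve through 0 has |γ(c)| →
0 as c → 0±, so by the intermediate value theorem it meets every small Cₙ at some c₊ > 0 and some c₋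
< 0, both forced to equal pₙ — contradicting injectivity. This is why the three clause cruxes carry
the robust (enrichment-stable) form: comeagre and prevalent sets are closed under countable
intersection (Baire; HuntSauerYorke1992 Fact 3″), Christodoulou's typed notion is not. [difficulty:
provable-now] -/
@[route_item "route-FinalStateConjecture-RobustClausewiseGenericity"]
def PlanarNonClosure : Prop :=
  let C : Set (EuclideanSpace ℝ (Fin 2)) → Prop := fun E ↦ ∀ p ∈ E, ∃ γ : ℝ → EuclideanSpace ℝ (Fin 2), ContDiff ℝ ((⊤ : ℕ∞) : WithTop ℕ∞) γ ∧ γ 0 = p ∧ Function.Injective γ ∧ ∀ c : ℝ, c ≠ 0 → γ c ∉ E; ∃ E₁ E₂ : Set (EuclideanSpace ℝ (Fin 2)), C E₁ ∧ C E₂ ∧ ¬ C (E₁ ∪ E₂)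

-- earlier Assembly (stmt-FinalStateConjecture-10135, replaced 2026-08-16T23:20:43Z -> stmt-FinalStateConjecture-17500): proved by Summit.FinalStateConjecture.FinalStateConjecture.Theorems.RobustClausewiseGenericity.assembly_proof @ a0e160b2a018 — CensorshipRobust → SettlingRobust → ThirdLawRobust → GaugeEnrichment → MGHDExists → FinalStateConjecture
-- earlier Assembly (stmt-FinalStateConjecture-17500, replaced 2026-08-17T00:29:23Z -> stmt-FinalStateConjecture-16825): retired by None — CensorshipRobust → SettlingRobust → ThirdLawRobust → PointedGaugeEnrichment → TameWitnessOfLocalFamily → MGHDExists → FinalStateConjecture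
/-- item stmt-FinalStateConjecture-16825 · assembly · rank 1 · closed · proved by Summit.FinalStateConjecture.FinalStateConjecture.Theorems.RobustClausewiseGenericity.assembly_proof @ a4fb4caba942 (prover) · by planner
sources: Christodoulou1999, HuntSauerYorke1992, AngelopoulosKehleUnger2026
[assembly] SettlingRobust → CensorshipRobust → ThirdLawRobust → MGHDExists → FinalStateConjecture —
the conjunction lemma of the Thesis in TAME form, restated 1:1 to the crux-only shape (route-repair
2026-08-17). ITS PROOF IS THE DECIDING THEOREM `closes` of this file (sorry-free; pointed gauge
enrichment, general position, arctan-squashed radial curve, tame packaging on the collared end,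
immersion chain rule — all inside the proof term): a prover closes this item with `fun hS hC hT hM ↦
closes hS hC hT hM` from a Theorems file. The earlier forms (stmt-10135, proved pre-T2 by
assembly_proof @fef18d4702ce; stmt-17500 rev 5 with the T2 supports
PointedGaugeEnrichment/TameWitnessOfLocalFamily as extra hypotheses) are superseded; those two
supports were dropped because their content is proved inside `closes`. -/
@[route_item "route-FinalStateConjecture-RobustClausewiseGenericity"]
def Assembly : Prop :=
  SettlingRobust → CensorshipRobust → ThirdLawRobust → MGHDExists → FinalStateConjecture

-- `Assembly` holds: proved by `Summit.FinalStateConjecture.FinalStateConjecture.Theorems.RobustClausewiseGenericity.assembly_proof` @ a4fb4caba942 (its module imports this route file, so no `_holds` link can be stated here).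

/-! D-0027 §2.1 — DECIDING THEOREM (planner-authored via `route open/edit --closes-file`; by planner-rbadge-FinalStateConjecture-RobustClau-a4b6f4d9-0 2026-08-17T00:29:23Z):
its hypotheses are this route's items and its conclusion the sub-problem Statement (glue_lint), and it elaborates with this file. -/

@[closes "route-FinalStateConjecture-RobustClausewiseGenericity"] theorem closes (hS : SettlingRobust) (hB : CensorshipRobust) (hT : ThirdLawRobust) (hM : MGHDExists) :
    _root_.FinalStateConjecture := by
  intro X _ _ _ _ _ _ d hd
  obtain ⟨hdA, -⟩ := hd
  have h1 := hB X d hdA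
  have h2 := hS X d hdA
  have h3 := hT X d hdA
  dsimp only at h1 h2 h3
  obtain ⟨n₁, G₁, L₁, -, hT₁, -, hR₁⟩ := h1 0 (fun _ ↦ d)
    ⟨Literature.Geometry.Lorentzian.InitialDataSet.isSmoothDataFamily_const 0 d, rfl, fun _ ↦ hdA,
      ∅, isCompact_empty, fun _ _ _ ↦ ⟨rfl, rfl⟩⟩
  obtain ⟨n₂, G₂, L₂, hL₂, hT₂, hGL₂, hR₂⟩ := h2 n₁ G₁ hT₁
  obtain ⟨n, G₃, L₃, hL₃, ⟨hGs, hG0, hGa, K, hK, hGK⟩, hGL₃, hR₃⟩ := h3 n₂ G₂ hT₂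
  clear h1 h2 h3 hB hS hT
  obtain ⟨-, e, Mass, hsole, hdecay⟩ := id hdA
  obtain ⟨z₀, hz₀⟩ := exists_norm_eq (EuclideanSpace ℝ (Fin 3)) (show (0 : ℝ) ≤ e.R + 3 by linarith [e.R_pos])
  have hz : e.R < ‖z₀‖ := by rw [hz₀]; linarith
  have B : e.BreathingData z₀ 1 := ⟨one_pos, by rw [hz₀]; linarith⟩
  obtain ⟨pr, hpr⟩ : ∃ pr : EuclideanSpace ℝ (Fin (n + 1)) →L[ℝ] EuclideanSpace ℝ (Fin n),
      ∀ q i, pr q i = q (Fin.castSucc i) :=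
    ⟨(EuclideanSpace.equiv (Fin n) ℝ).symm.toContinuousLinearMap.comp
      (.pi fun i ↦ EuclideanSpace.proj (Fin.castSucc i)), fun q i ↦ by simp⟩
  obtain ⟨L, hL1, hL2⟩ : ∃ L : EuclideanSpace ℝ (Fin n) →ₗ[ℝ] EuclideanSpace ℝ (Fin (n + 1)),
      (∀ c i, L c (Fin.castSucc i) = c i) ∧ ∀ c, L c (Fin.last n) = 0 :=
    ⟨(EuclideanSpace.equiv (Fin (n + 1)) ℝ).symm.toLinearEquiv.toLinearMap ∘ₗ
      (.pi fun j ↦ Fin.lastCases (motive := fun _ ↦ EuclideanSpace ℝ (Fin n) →ₗ[ℝ] ℝ) 0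
        (fun i ↦ (EuclideanSpace.proj i).toLinearMap) j), fun c i ↦ by simp, fun c ↦ by simp⟩
  obtain ⟨τ, hτ⟩ : ∃ τ : EuclideanSpace ℝ (Fin (n + 1)) →L[ℝ] ℝ, ∀ q, τ q = q (Fin.last n) :=
    ⟨EuclideanSpace.proj (Fin.last n), fun _ ↦ rfl⟩
  have hprL : ∀ c, pr (L c) = c := fun c ↦ by ext i; rw [hpr, hL1]
  have hLi : Function.Injective L := Function.LeftInverse.injective hprL
  obtain ⟨w, hprw, hτw⟩ : ∃ w, pr w = 0 ∧ τ w = 1 :=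
    ⟨EuclideanSpace.single (Fin.last n) 1, by
      ext i; rw [hpr, PiLp.single_apply, if_neg (Fin.castSucc_lt_last i).ne]; rfl, by
      rw [hτ, PiLp.single_apply, if_pos rfl]⟩
  let G₄ := fun q ↦ Literature.Geometry.Lorentzian.AFEnd.breatheFamily B (G₃ (pr q)) (τ q)
  obtain ⟨e₁, he₁⟩ := exists_ne (0 : EuclideanSpace ℝ (Fin 3))
  let x₀ := e.dataChartExt z₀
  let v₀ : TangentSpace (𝓡 3) x₀ := mfderiv 𝓘(ℝ, EuclideanSpace ℝ (Fin 3)) (𝓡 3) e.dataChartExt z₀ e₁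
  have hv₀ : v₀ ≠ 0 := fun h ↦ he₁ (e.injective_mfderiv_dataChartExt hz (h.trans (map_zero _).symm))
  let Λ := fun D : Literature.Geometry.Lorentzian.InitialDataSet (𝓡 3) X ↦ D.h.inner x₀ v₀ v₀
  have hA : 0 < Λ d := d.h.pos x₀ v₀ hv₀
  have hΛG : Λ ∘ G₄ = fun q ↦ (1 + Literature.Geometry.Lorentzian.AFEnd.squash B (τ q)) ^ 2 * Λ (G₃ (pr q)) :=
    funext fun q ↦ Literature.Geometry.Lorentzian.AFEnd.breatheFamily_h_inner_center B _ _ v₀ v₀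
  have hF : ContDiff ℝ (⊤ : ℕ∞) fun c ↦ Λ (G₃ c) := by
    rw [show (fun c ↦ Λ (G₃ c)) = fun c ↦ e.hCoeff (G₃ c) z₀ e₁ e₁ from
      funext fun c ↦ (e.hCoeff_apply_eq_dataChartExt (G₃ c) hz e₁ e₁).symm, contDiff_iff_contDiffAt]
    intro c
    have h : ContDiffAt ℝ (⊤ : ℕ∞)
        ((Function.uncurry fun p z ↦ e.hCoeff (G₃ p) z) ∘ fun c' ↦ (c', z₀)) c :=
      (Literature.Geometry.Lorentzian.AFEnd.contDiffAt_hCoeff_family hGs.1 c hz).comp c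
        (contDiffAt_id.prodMk contDiffAt_const)
    exact ((show ContDiffAt ℝ (⊤ : ℕ∞) (fun c' ↦ e.hCoeff (G₃ c') z₀) c from h).clm_apply
      contDiffAt_const).clm_apply contDiffAt_const
  have hC1 : ContDiff ℝ 1 (Λ ∘ G₄) := by
    rw [hΛG]
    exact (((contDiff_const.add ((Literature.Geometry.Lorentzian.AFEnd.contDiff_squash B (n := ⊤)).comp
      τ.contDiff)).pow 2).mul (hF.comp pr.contDiff)).of_le (by exact_mod_cast le_top)
  have hT₄ : Literature.Geometry.Lorentzian.InitialDataSet.IsSmoothDataFamily (n + 1) G₄ ∧ G₄ 0 = d ∧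
      (∀ c, G₄ c ∈ Literature.Geometry.Lorentzian.admissibleVacuumData X) ∧
      ∃ K : Set X, IsCompact K ∧ ∀ c, ∀ x ∉ K, (G₄ c).h.inner x = d.h.inner x ∧ (G₄ c).k x = d.k x := by
    refine ⟨⟨Literature.Geometry.Lorentzian.AFEnd.contMDiff_breatheFamily_family_h B pr.contDiff τ.contDiff hGs.1,
      Literature.Geometry.Lorentzian.AFEnd.contMDiff_breatheFamily_family_k B pr.contDiff τ.contDiff hGs.2⟩, ?_,
      fun q ↦ Literature.Geometry.Lorentzian.InitialDataSet.mem_admissibleVacuumData_of_agree_off_compact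
        (hGa (pr q)) ?_ (Literature.Geometry.Lorentzian.AFEnd.isCompact_breatheCore B) fun x hx ↦
          Literature.Geometry.Lorentzian.AFEnd.breatheFamily_eq_of_not_mem_core B _ _ hx,
      K ∪ e.breatheCore z₀ 1, hK.union (Literature.Geometry.Lorentzian.AFEnd.isCompact_breatheCore B),
      fun q x hx ↦ ?_⟩
    · show Literature.Geometry.Lorentzian.AFEnd.breatheFamily B (G₃ (pr 0)) (τ 0) = d
      rw [map_zero, map_zero, Literature.Geometry.Lorentzian.AFEnd.breatheFamily_zero, hG0]
    · intro inst
      haveI := (G₃ (pr q)).metric.hasLeviCivita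
      exact Literature.Geometry.Lorentzian.AFEnd.isVacuumConstraintSolution_breatheFamily B _ (hGa (pr q)).1.1 _
    · rw [Set.mem_union, not_or] at hx
      obtain ⟨h1, h2⟩ := Literature.Geometry.Lorentzian.AFEnd.breatheFamily_eq_of_not_mem_core B _ _ hx.2
      exact ⟨h1.trans (hGK _ x hx.1).1, h2.trans (hGK _ x hx.1).2⟩
  have hGL₄ : ∀ c, G₄ (L c) = G₃ c := fun c ↦ by
    show Literature.Geometry.Lorentzian.AFEnd.breatheFamily B (G₃ (pr (L c))) (τ (L c)) = _
    rw [hprL, hτ, hL2, Literature.Geometry.Lorentzian.AFEnd.breatheFamily_zero]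
  have hdir : ∀ y, HasDerivAt (fun t : ℝ ↦ (Λ ∘ G₄) (t • y)) (fderiv ℝ (Λ ∘ G₄) 0 y) 0 := fun y ↦ by
    have h := ((hC1.differentiable one_ne_zero) ((0 : ℝ) • y)).hasFDerivAt.comp_hasDerivAt (0 : ℝ)
      ((hasDerivAt_id (0 : ℝ)).smul_const y)
    rwa [zero_smul, one_smul] at h
  have harc : ∀ k : ℝ, HasDerivAt (fun t ↦ k * Real.arctan t) k 0 := fun k ↦ by
    have h := (Real.hasDerivAt_arctan 0).const_mul k
    simp only [ne_eq, OfNat.ofNat_ne_zero, not_false_eq_true, zero_pow, add_zero, div_one, mul_one] at h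
    exact h
  have hΛw : fderiv ℝ (Λ ∘ G₄) 0 w ≠ 0 := by
    have hc := hdir w
    have hl : (fun t : ℝ ↦ (Λ ∘ G₄) (t • w)) = fun t ↦
        (1 + Literature.Geometry.Lorentzian.AFEnd.squash B t) ^ 2 * Λ d := by
      funext t; rw [hΛG]; simp only [map_smul, hprw, hτw, smul_zero, smul_eq_mul, mul_one, hG0]
    rw [hl] at hc
    rw [hc.unique ((((harc _).const_add 1).pow 2).mul_const _), Real.arctan_zero]
    have := (Literature.Geometry.Lorentzian.AFEnd.breatheScale_spec B).1
    positivity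
  obtain ⟨US, hUSo, hUSd, hUS⟩ := hR₃ _ G₄ L hLi hT₄ hGL₄
  obtain ⟨UC, hUCo, hUCd, hUC⟩ := hR₂ _ G₄ (L ∘ₗ L₃) (fun a b h ↦ hL₃ (hLi h)) hT₄
    fun c ↦ by rw [LinearMap.comp_apply, hGL₄, hGL₃]
  obtain ⟨UB, hUBo, hUBd, hUB⟩ := hR₁ _ G₄ (L ∘ₗ L₃ ∘ₗ L₂) (fun a b h ↦ hL₂ (hL₃ (hLi h))) hT₄
    fun c ↦ by rw [LinearMap.comp_apply, LinearMap.comp_apply, hGL₄, hGL₃, hGL₂]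
  have hUd : Dense {v | fderiv ℝ (Λ ∘ G₄) 0 v ≠ 0} := fun v ↦ by
    by_cases hv : fderiv ℝ (Λ ∘ G₄) 0 v = 0
    · have h1 : Tendsto (fun k : ℕ ↦ (1 / ((k : ℝ) + 1)) • w) atTop (𝓝 ((0 : ℝ) • w)) :=
        tendsto_one_div_add_atTop_nhds_zero_nat.smul_const w
      rw [zero_smul] at h1
      have ht : Tendsto (fun k : ℕ ↦ v + (1 / ((k : ℝ) + 1)) • w) atTop (𝓝 v) := by
        simpa using tendsto_const_nhds.add h1
      refine mem_closure_of_tendsto ht (Eventually.of_forall fun k ↦ ?_)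
      simp only [Set.mem_setOf_eq, map_add, map_smul, hv, zero_add, smul_eq_mul]
      exact mul_ne_zero (one_div_ne_zero (Nat.cast_add_one_ne_zero k)) hΛw
    · exact subset_closure hv
  obtain ⟨u, ⟨⟨huB, huC⟩, huS⟩, hu⟩ := (((hUBd.inter_of_isOpen_right hUCd hUCo).inter_of_isOpen_right
    hUSd hUSo).inter_of_isOpen_right hUd
      (isOpen_ne_fun (fderiv ℝ (Λ ∘ G₄) 0).continuous continuous_const)).nonempty
  replace hu : fderiv ℝ (Λ ∘ G₄) 0 u ≠ 0 := hu
  obtain ⟨δB, hδB, hQB⟩ := hUB u huB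
  obtain ⟨δC, hδC, hQC⟩ := hUC u huC
  obtain ⟨δS, hδS, hQS⟩ := hUS u huS
  obtain ⟨δΛ, hδΛ, hinj⟩ : ∃ δ > (0 : ℝ), ∀ t t', |t| < δ → |t'| < δ →
      (Λ ∘ G₄) (t • u) = (Λ ∘ G₄) (t' • u) → t = t' := by
    have hg : ContDiff ℝ 1 fun t : ℝ ↦ fderiv ℝ (Λ ∘ G₄) 0 u * (Λ ∘ G₄) (t • u) :=
      contDiff_const.mul (hC1.comp (contDiff_id.smul contDiff_const))
    have h0 : 0 < deriv (fun t : ℝ ↦ fderiv ℝ (Λ ∘ G₄) 0 u * (Λ ∘ G₄) (t • u)) 0 := by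
      rw [((hdir u).const_mul _).deriv]; exact mul_self_pos.2 hu
    obtain ⟨δ, hδ, hb⟩ := Metric.eventually_nhds_iff.1
      ((hg.continuous_deriv le_rfl).continuousAt.eventually (lt_mem_nhds h0))
    refine ⟨δ, hδ, fun t t' ht ht' h ↦ (strictMonoOn_of_deriv_pos (convex_Ioo (-δ) δ)
      hg.continuous.continuousOn fun x hx ↦ hb ?_).injOn (by simpa [abs_lt] using ht)
        (by simpa [abs_lt] using ht') ?_⟩
    · rw [interior_Ioo] at hx; simpa [Real.dist_eq, abs_lt] using hx
    · simp only [h]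
  obtain ⟨ε, hε, hεB, hεC, hεS, hεΛ⟩ : ∃ ε > (0 : ℝ), ε ≤ δB ∧ ε ≤ δC ∧ ε ≤ δS ∧ ε ≤ δΛ :=
    ⟨_, lt_min (lt_min hδB hδC) (lt_min hδS hδΛ), (min_le_left _ _).trans (min_le_left _ _),
      (min_le_left _ _).trans (min_le_right _ _), (min_le_right _ _).trans (min_le_left _ _),
      (min_le_right _ _).trans (min_le_right _ _)⟩
  have hε2 := half_pos hε
  obtain ⟨hG₄s, hG₄0, hG₄a, K₄, hK₄, hG₄K⟩ := hT₄
  obtain ⟨P, hP⟩ : ∃ P : EuclideanSpace ℝ (Fin 1) →L[ℝ] ℝ, ∀ c, P c = c 0 := ⟨EuclideanSpace.proj 0, fun _ ↦ rfl⟩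
  have hPi : ∀ c c', P c = P c' → c = c' := fun c c' h ↦ by
    rw [hP, hP] at h; ext i; fin_cases i; exact h
  have hP0 : ∀ c, c ≠ 0 → P c ≠ 0 := fun c hc h0 ↦ hc (hPi c 0 (by rw [h0, map_zero]))
  obtain ⟨ρ, hρ⟩ : ∃ ρ : ℝ → ℝ, ρ = fun t ↦ ε / 2 * Real.arctan t := ⟨_, rfl⟩
  have hρ0 : ρ 0 = 0 := by simp [hρ]
  have hρs : ContDiff ℝ (⊤ : ℕ∞) ρ := by rw [hρ]; exact contDiff_const.mul Real.contDiff_arctan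
  have hρi : Function.Injective ρ := fun t t' h ↦ by
    rw [hρ] at h; exact Real.arctan_injective (mul_left_cancel₀ hε2.ne' h)
  have hρε : ∀ t, |ρ t| < ε := fun t ↦ by
    rw [hρ]; show |ε / 2 * Real.arctan t| < ε
    rw [abs_mul, abs_of_pos hε2]
    have := mul_lt_mul_of_pos_left ((abs_lt.2 ⟨Real.neg_pi_div_two_lt_arctan t,
      Real.arctan_lt_pi_div_two t⟩).trans_le (by linarith [Real.pi_le_four] : Real.pi / 2 ≤ 2)) hε2
    linarith
  have hρd : HasDerivAt ρ (ε / 2) 0 := by rw [hρ]; exact harc _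
  let H := fun c ↦ G₄ (ρ (P c) • u)
  have hHs := hG₄s.comp_contDiff ((hρs.comp P.contDiff).smul (contDiff_const (c := u)))
  have hH0 : H 0 = d := by
    show G₄ (ρ (P 0) • u) = d; rw [map_zero, hρ0, zero_smul]; exact hG₄0
  have hHK : ∀ c, ∀ x ∉ K₄, (H c).h.inner x = (H 0).h.inner x ∧ (H c).k x = (H 0).k x := fun c x hx ↦ by
    rw [hH0]; exact hG₄K _ x hx
  have hSAF : e.IsStronglyAsymptoticallyFlatDR (H 0) Mass := by rw [hH0]; exact hdecay
  refine ⟨_, H, Literature.Geometry.Lorentzian.InitialDataSet.isTameDataFamily_restrict_of_agree_off_compact_one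
    hHs hsole hSAF hK₄ hHK (lt_add_one e.R), fun v' hv' ↦ ⟨x₀, v₀, v₀, .inl ?_⟩, hH0, fun c c' h ↦ ?_,
    fun c ↦ hG₄a _, fun c hc hm ↦ hm.2 ⟨hM X _ (hG₄a _), fun 𝒟 hmax ↦ ?_⟩⟩
  · have h1 : HasDerivAt (fun t : ℝ ↦ (Λ ∘ G₄) (t • u)) (fderiv ℝ (Λ ∘ G₄) 0 u) (ρ (P 0)) := by
      rw [map_zero, hρ0]; exact hdir u
    have h2 : HasDerivAt ρ (ε / 2) (P 0) := by rw [map_zero]; exact hρd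
    rw [show (fun c ↦ (H c).h.inner x₀ v₀ v₀) = ((fun t : ℝ ↦ (Λ ∘ G₄) (t • u)) ∘ ρ) ∘ P from rfl,
      ((h1.comp (P 0) h2).comp_hasFDerivAt 0 P.hasFDerivAt).fderiv]
    show fderiv ℝ (Λ ∘ G₄) 0 u * (ε / 2) * P v' ≠ 0
    exact mul_ne_zero (mul_ne_zero hu hε2.ne') (hP0 v' hv')
  · have h' : (Λ ∘ G₄) (ρ (P c) • u) = (Λ ∘ G₄) (ρ (P c') • u) := congrArg Λ h
    exact hPi c c' (hρi (hinj _ _ ((hρε _).trans_le hεΛ) ((hρε _).trans_le hεΛ) h'))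
  · have ht : ρ (P c) ≠ 0 := fun h ↦ hP0 c hc (hρi (h.trans hρ0.symm))
    obtain ⟨O, dd, hO, hr, hx, hf⟩ := hQC _ ht ((hρε _).trans_le hεC) 𝒟 hmax
    exact ⟨hQB _ ht ((hρε _).trans_le hεB) 𝒟 hmax, O, dd,
      hQS _ ht ((hρε _).trans_le hεS) 𝒟 hmax O dd hO hx, hO, hr, hx, hf⟩

end Summit.FinalStateConjecture.FinalStateConjecture.Theses.RobustClausewiseGenericity
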